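import Mathlib
import Literature.NumberTheory.LFunctions.ZetaZeros
import HarnessLib

/-!
# Soundararajan's `V`-typical ordinates of his method for `M(x)` under RH (Balazard–de Roton 2008)

Topic `Literature/NumberTheory/LFunctions`, next to `MertensBoundRH.lean` (`M(x) ≪ x^{1/2+ε}` under
RH, Littlewood–Titchmarsh) and the Balazard–de Roton 2010 files `NymanBeurlingRate*.lean`, whose
proof of `Literature.NumberTheory.LFunctions.BalazardDeRoton2010_thm1` (the rate
`d_N² ≪ (log log N)^{5/2+δ}(log N)^{-1/2}` in the Nyman–Beurling criterion under RH) needs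
Soundararajan's method for the partial sums of the Möbius function (K. Soundararajan, *Partial sums
of the Möbius function*, J. reine angew. Math. 631 (2009) 141–152 = arXiv:0705.0723) in the refined
form of M. Balazard, A. de Roton, *Notes de lecture de l'article "Partial sums of the Möbius
function" de Kannan Soundararajan*, arXiv:0810.3587 (both read in full). This file vendors the
DEFINITION of a `V`-typical ordinate (with its Dirichlet polynomial), in terms of which the three
deep statements of that method from which the contour argument proceeds — Propositions 1, 18 and 20
of arXiv:0810.3587, quoted below — are taken as HYPOTHESES by the files proving
`BalazardDeRoton2010_thm1` from them (they are not vendored as named facts here; asymptotic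
locutions "`T` assez grand", `O(·)`, `≪` are rendered there by existential constants, see Design).

## Source, verbatim (arXiv:0810.3587)

§1, p. 2: "On se donne un paramètre `δ`, tel que `0 < δ ≤ 1`. Soit `T` assez grand et `V` tel que
`(log log T)² ≤ V ≤ log T/log log T`. Un nombre réel `t` est appelé une *ordonnée `V`-typique de
taille `T`* si • `T ≤ t ≤ 2T` ; (i) pour tout `σ ≥ 1/2`, on a
`|Σ_{n≤x} Λ(n)/(n^{σ+it} log n) · log(x/n)/log x| ≤ 2V`, où `x = T^{1/V}` ; (ii) tout
sous-intervalle de `[t−1,t+1]` de longueur `2δπV/log T` contient au plus `(1+δ)V` ordonnées de zéros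
de `ζ` ; (iii) tout sous-intervalle de `[t−1,t+1]` de longueur `2πV/((log V) log T)` contient au
plus `V` ordonnées de zéros de `ζ`. Si `t ∈ [T,2T]` ne vérifie pas l'une des assertions (i), (ii),
(iii), on dira que `t` est une ordonnée `V`-atypique de taille `T`."

> **Proposition 1.** (HR) Soit `T` assez grand et `V` tel que `(log log T)² ≤ V ≤ log T/log log T`.
> Soit `t` une ordonnée `V`-typique de taille `T`. On a
> `log|ζ(σ+it)| ≥ −V log((V/log T)/(σ−1/2)) − 2(1+δ)V log log V + O(Vδ^{-2})` si
> `1/2 < σ ≤ 1/2 + V/log T`, et `log|ζ(σ+it)| ≥ O(Vδ^{-1})` si `1/2 + V/log T ≤ σ ≤ 2`.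

> **Proposition 18.** Soit `T` assez grand, et `V` tel que
> `1/2 + log log log T/log log T ≤ V log log T/log T ≤ 1`. Alors toute ordonnée `t ∈ [T,2T]` est
> `V`-typique.

> **Proposition 20.** (RH) Soit • `T` assez grand ; • `2(log log T)² ≤ V ≤ log T/log log T` ;
> • `T ≤ t₁ < t₂ < … < t_R ≤ 2T` des ordonnées `V`-atypiques telles que `t_{r+1} − t_r ≥ 1`,
> `1 ≤ r < R`. Alors `R ≪ T exp(−V log(V/log log T) + 2V log log V + O(V))`.

(Soundararajan's originals: Definition 3, Proposition 5 and Proposition 4 of arXiv:0705.0723, with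
`3V` in (ii) and `(log log x)^{14}`-quality constants.) Proposition 1 is proved in §2 of
arXiv:0810.3587 from the Hadamard product, an explicit formula with the kernel `log(x/n)` and the
typicality conditions; Proposition 18 in §6 from the Goldston–Gonek bound
`|N(t+h)−N(t−h)−(h/π)log(t/2π)| ≤ log t/(2 log log t) + (1/2+o(1)) log t log log log t/(log log t)²`
(their Prop. 16, proved in §5 under RH from the Guinand–Weil explicit formula and the
Beurling–Selberg functions; hence RH is a hypothesis of our Prop. 18 as well); Proposition 20 in §7
from the Maier–Montgomery large-sieve moment inequality (their Prop. 13) and §5.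

## Design

* `Soundararajan.typicalSum x σ t` is the Dirichlet polynomial of (i); `Soundararajan.IsTypical δ T V t`
  is "`t` is a (`δ`,)`V`-typical ordinate of size `T`" with the ordinate counts of (ii), (iii) read
  through `N(·) = Literature.NumberTheory.LFunctions.zetaZeroCount` (zeros with `0 < γ ≤ ·`, with
  multiplicity): "every sub-interval `]t'−h, t'+h]` of `[t−1, t+1]` contains at most `K` ordinates"
  is `N(t'+h) − N(t'−h) ≤ K` whenever `t − 1 ≤ t' − h` and `t' + h ≤ t + 1` — the half-open
  convention of the source's own verifications (§6: `N(t'+h) − N(t'−h) ≤ …`; §7: "il existe `t'_r`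
  tel que … `N(t'_r + h) − N(t'_r − h) ≥ (1+δ)V − 1`").
* "`T` assez grand" (absolute in the source, footnote 1) and the implied constants of `O(·)`, `≪`
  are rendered as `∃ T₀`, `∃ D`, `∃ C` AFTER the quantifier on `δ ∈ (0,1]` (a formally weaker, hence
  safe, reading; all uses fix `δ`). `log|ζ| ≥ O(Vδ^{-1})` is `−D V δ^{-1} ≤ log|ζ(σ+it)|`.
* RH is Mathlib's `RiemannHypothesis`; `Λ` is `ArithmeticFunction.vonMangoldt`.

## References

* [BalazardRoton2008] M. Balazard, A. de Roton, Notes de lecture de l'article "Partial sums of the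
  Möbius function" de Kannan Soundararajan, arXiv:0810.3587, §1 (definition), Prop. 1 (p. 2),
  Prop. 18 (§6, p. 9), Prop. 20 (§7, p. 10).
* K. Soundararajan, Partial sums of the Möbius function, J. reine angew. Math. 631 (2009) 141–152
  (arXiv:0705.0723), Definition 3, Propositions 4, 5.
* [BalazardDeRoton2010] M. Balazard, A. de Roton, Int. J. Number Theory 6 (2010) 883–903, §5 (the
  same statements as their Propositions 6 and 9, consumers of this file).
-/

noncomputable section

open Complex

namespace Literature.NumberTheory.LFunctions

namespace Soundararajan

/-- The Dirichlet polynomial of criterion (i):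
`Σ_{n ≤ x} Λ(n)/(n^{σ+it} log n) · log(x/n)/log x` (the term `n = 1` vanishes as `Λ(1) = 0`).
[cite: BalazardRoton2008, §1 (i)] -/
def typicalSum (x σ t : ℝ) : ℂ :=
  ∑ n ∈ Finset.Icc 1 ⌊x⌋₊,
    ((ArithmeticFunction.vonMangoldt n / Real.log n * (Real.log (x / n) / Real.log x) : ℝ) : ℂ) *
      (n : ℂ) ^ (-((σ : ℂ) + t * I))

/-- **`t` is a `V`-typical ordinate of size `T`** (with parameter `0 < δ ≤ 1`; Balazard–de Roton
2008 §1, after Soundararajan 2009 Definition 3): `T ≤ t ≤ 2T`; (i) for every `σ ≥ 1/2`,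
`|Σ_{n≤x} Λ(n)/(n^{σ+it} log n)·log(x/n)/log x| ≤ 2V` with `x = T^{1/V}`; (ii) every sub-interval
`]t'−h, t'+h]` of `[t−1, t+1]` with `h = πδV/log T` contains at most `(1+δ)V` ordinates of zeros of
`ζ` (with multiplicity: `N(t'+h) − N(t'−h) ≤ (1+δ)V`); (iii) the same with
`h = πV/((log V) log T)` and at most `V` ordinates. [cite: BalazardRoton2008, §1] -/
def IsTypical (δ T V t : ℝ) : Prop :=
  T ≤ t ∧ t ≤ 2 * T ∧
    (∀ σ : ℝ, 1 / 2 ≤ σ → ‖typicalSum (T ^ (1 / V)) σ t‖ ≤ 2 * V) ∧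
    (∀ t' : ℝ, t - 1 ≤ t' - Real.pi * δ * V / Real.log T →
      t' + Real.pi * δ * V / Real.log T ≤ t + 1 →
      (zetaZeroCount (t' + Real.pi * δ * V / Real.log T) : ℝ) -
          zetaZeroCount (t' - Real.pi * δ * V / Real.log T) ≤ (1 + δ) * V) ∧
    (∀ t' : ℝ, t - 1 ≤ t' - Real.pi * V / (Real.log V * Real.log T) →
      t' + Real.pi * V / (Real.log V * Real.log T) ≤ t + 1 →
      (zetaZeroCount (t' + Real.pi * V / (Real.log V * Real.log T)) : ℝ) -
          zetaZeroCount (t' - Real.pi * V / (Real.log V * Real.log T)) ≤ V)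

/-- Unfolding of `IsTypical` (its first two clauses: the size condition `T ≤ t ≤ 2T`).
[cite: BalazardRoton2008, §1] -/
theorem IsTypical.size {δ T V t : ℝ} (h : IsTypical δ T V t) : T ≤ t ∧ t ≤ 2 * T :=
  ⟨h.1, h.2.1⟩

/-- Criterion (i) of a typical ordinate. [cite: BalazardRoton2008, §1 (i)] -/
theorem IsTypical.sum_le {δ T V t : ℝ} (h : IsTypical δ T V t) {σ : ℝ} (hσ : 1 / 2 ≤ σ) :
    ‖typicalSum (T ^ (1 / V)) σ t‖ ≤ 2 * V :=
  h.2.2.1 σ hσ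

end Soundararajan

end Literature.NumberTheory.LFunctions

end
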